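import Summits.QuantumFields.BalabanUV.Beta.D1BFx.RestKernelBlockUnit
import Summits.QuantumFields.BalabanUV.Beta.D1BFx.GhostWordJetLetters

/-!
# `BalabanUV.Beta.D1BFx.RestJetBlockMass` — road «BF-x» for binder row D1, slot (K), DICT-CHAIN-SPEC §2 (II) rows RK-BLK ∕ RK-SAND: **«RK-JET BLOCK MASSES» —
# THE CENTRED WEIGHTED MASS OF A PACKED FIRST JET `vertexOf S μ y` (any first-jet PACK `S`, any block) IS `≤ C_V·n⁻¹ ×` THE STENCILS' OWN MASS LETTER**,
# `C_V = 4·(MG163 4·periodConst (kappa163 4) 3)·e^{κ′}·(1 + 16∕κ′)⁴`, `κ′ = kappa163 4∕4` (UNCONDITIONAL: road FP's minimiser envelope `abs_wH_fine_le` summed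
# against a slow exponential, `GhostWordJetLetters.tsum_abs_wH_mul_exp_le`, volume `(n⁴)⁻¹·Zl 4 (κ′∕(8n)) ≤ (1 + 16∕κ′)⁴`), hence for the ROAD's packed first jets
# `vertexOfK (NlegRoad m a) n S = vertexOf S` (mod `h12 ∧ h126`, `NlegKHessSplit.vertexOfK_NlegRoad_eq_vertexOf`), and the FIFTEEN RK-BLK BUBBLE WORDS AT THOSE JETS
# are `Decay510` at the n-FREE rate `c` with constants `½·T_ij·T_kl·(C_V n⁻¹ mS_jk)·(C_V n⁻¹ mS_li)` — generic in the stencil pack `S`, its BLOCK mass letters `mS j k` displayed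

STATUS: [folklore] `ℓ¹` bookkeeping over this lineage's `GhostWordJetMass.mass_wsum_le` ∕ `mass_finset_sum_le` (g18 FILE 3a), `GhostWordJetLetters.tsum_abs_wH_mul_exp_le`
∕ `Zl_kappa_le` (g18 FILE 3b) and FILE `RestKernelBlockUnit` (this gen); 0 `sorry`; 0 new definitions; 0 notation; 0 cited facts beyond the two named hypotheses
`h12 ∕ h126` of the road's read-out (§3–§4 only).  HONEST: 0 root-level binders discharged (hW ∕ hR-sockets ∕ hSX-socket ∕ D1Tel ∕ D1Rep — 0); (K) NOT closed
(the N-side dictionary (A2-N) must still say WHICH stencil pack `S_N` ∕ table pack the N-jets carry and supply their block mass letters `mS j k(n)`; the tables'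
block masses and the slot's `hptw` are not here); NOT D1, NOT `BetaPertH`, NOT continuum, NOT Clay.
HONEST DEPENDENCY (cell records, verbatim): «continuum YM on T⁴ ⇐ BetaPertH ∧ nine spine estimates (0/9 proved); BetaPertH ⇐ (D1) ∧ (D4) ∧
CAP+tail; G-an2-4 gates asym, D1 and NE2/3/4.»

ABSOLUTE RULE (cell charter, verbatim): «No internally-minted statement may enter as a cited fact. Every hypothesis is either kernel-proved in
this package or a verbatim quotation of a PUBLISHED theorem with page reference. The manuscript(s) under audit are NOT citable for their own
disputed steps — they are the thing under adjudication; programme-internal (2001/route/tribunal) claims are never citable.»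

WHY.  FILE `RestKernelBlockUnit` (and leaf-01's `RestKernelSandwichUnit`) bound every rest word by leg letters × the JETS' block masses `mV j k`, displayed; by
DICT-CHAIN-SPEC §1 (S-N) the road's N-side first jets ARE packed chain-rule vertices `vertexOfK (NlegRoad m a) n S_N = vertexOf S_N` — `ℋ`-superpositions
`Σ_{κ′} Σ'_u wH κ′ μ (u − n•y)·S_N κ′ u` of a first-jet PACK.  This file moves the displayed letter one level down, from the jets to the STENCILS: whatever `S_N`
is, each block of `vertexOf S_N μ y` has centred weighted mass `≤ C_V·n⁻¹·mS j k` where `mS j k` is the pack's own (u-centred) block mass letter — the minimiser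
weights pay `(n⁵)⁻¹ × Zl 4 (κ′∕(8n)) ≤ n⁻¹·(1 + 16∕κ′)⁴`.  `n = m + 1` throughout §2–§4.

CONTENT.
* §1 [folklore, any `D`, fibre `F`] `stencil_mass_recentre` (a u-centred mass letter at rate `σ ≥ 0` read at another centre `c` costs `e^{2σ|u − c|₁}`);
  **`mass_sum_wsum_le`** (mass of `Σ_{i∈s} wsum (w i) (K i)` from per-stencil masses `ρ i u` and weight letters `Σ'_u |w i u|·ρ i u ≤ M i`).
* §2 [folklore, `D = 4`, any fibre `F`, UNCONDITIONAL] **`mass_vertexRedF_le`**: for `0 ≤ σ ≤ κ′∕(16n)` and a pack `S` with `Σ'|S κ′ u|·e^{σ(|p−u|₁+|q−u|₁)} ≤ mS`,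
  the centred weighted mass of `vertexRedF n S μ y` at `n•y`, rate `σ`, is `≤ C_V·n⁻¹·mS`; [packed, fibre `Fib 3`] `blk_vertexOf` (`blk (vertexOf S μ y) j k =
  vertexRedF n (S·jk) μ y`, definitional — the all-block form of `PackedKernelSplit.ffV_vertexOf`), **`mass_blk_vertexOf_le`** (block letters `mS j k` ⊢ block masses
  `≤ C_V·n⁻¹·mS j k`).
* §3 [mod `h12 ∧ h126`] **`mass_blk_vertexOfK_NlegRoad_le`**: the same for the road's packed first jets `vertexOfK (NlegRoad m a) n S`.
* §4 [mod `h12 ∧ h126`] **`exists_decay510_blockWord_inr_packed`**: ONE n-free triple `kG, K ≥ 0`, `c > 0` such that for every `m`, every first-jet pack `S` with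
  block letters `mS j k` at rate `c∕n`, every table family `W`, all fifteen bubble block words at the road's packed first jets satisfy
  `Decay510 (blockWord (NlegRoad m a) (vertexOfK (NlegRoad m a) n S) W (inr (i, j, k, l)) μ ν) (½·T_ij·T_kl·(C_V n⁻¹ mS_jk)·(C_V n⁻¹ mS_li)) c` — RATE `c` n-FREE,
  `T` the leg table of `RestKernelBlockUnit.exists_road_block_legs` (one factor `n⁻⁵` per genuine word, `road_block_leg_nonff_le`) — i.e. `n⁻⁷ × mS_jk(n)·mS_li(n) ×`
  n-free letters per genuine bubble word; the pack's letters and their n-powers are (A2-N)'s.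
NOT HERE (honest): the table families' block masses (the 3 tadpole words keep FILE 1's displayed `mW j i`); which pack `S_N` the road carries; the `Rk` wiring.
Unit `b2b-balaban-beta-d1-formalise-leaf-04` (gen 19), D1 formalisation swarm leaf prover 04, road «BF-x»; INTENT 2 «RK-JET BLOCK MASSES» (journal).
-/

noncomputable section

open Finset
open scoped BigOperators
open Literature.MathematicalPhysics.QuantumFieldTheory.Balaban1983to89
open Literature.MathematicalPhysics.QuantumFieldTheory.Balaban1983to89.Beta
open B12Sec2to5 (l1 l1_nonneg Decay510)
open B5Hk163Strip (kappa163 kappa163_pos)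
open B5Hk163Decay (MG163)
open B4TorusKernel (periodConst)
open ExpKernelCalculus (Site MKer Decays Zl Zl_nonneg l1_sub_triangle)
open KernelSpecInstance (wH)
open OneStepResolventKernel (Fib wsum vertexOf)
open OneStepKernelFamily (vertexOfK)
open VectorTailsLoc (fam kfam)
open Summit.QuantumFields.BalabanUV.Beta.TameKernelCalculus (decays_of_le)
open Summit.QuantumFields.BalabanUV.Beta.D1BFx.PackedKernelSplit (blk biBubble)
open Summit.QuantumFields.BalabanUV.Beta.D1BFx.RWeightedLegPack (NlegRoad)
open Summit.QuantumFields.BalabanUV.Beta.D1BFx.FrozenLegTails (nOf MOf hn1)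
open Summit.QuantumFields.BalabanUV.Beta.GAN24.DirichletExhaustionDeltaZ (c166Z kappaZ)
open Summit.QuantumFields.BalabanUV.Beta.D1BFx.ReducedKernelF (vertexRedF)
open Summit.QuantumFields.BalabanUV.Beta.D1BFx.RestKernelWords (blockWord)
open Summit.QuantumFields.BalabanUV.Beta.D1BFx.NlegKHessSplit (vertexOfK_NlegRoad_eq_vertexOf)
open Summit.QuantumFields.BalabanUV.Beta.D1BFx.GhostWordJetMass (mass_wsum_le mass_finset_sum_le vertexRedF_eq_sum)
open Summit.QuantumFields.BalabanUV.Beta.D1BFx.GhostWordJetLetters (tsum_abs_wH_mul_exp_le Zl_kappa_le wH_const_nonneg)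
open Summit.QuantumFields.BalabanUV.Beta.D1BFx.RestKernelBlockUnit (exists_road_block_legs decay510_blockWord_inr)

namespace Summit.QuantumFields.BalabanUV.Beta.D1BFx.RestJetBlockMass

/-! ## §1 Generic: recentring a stencil letter; mass of a finite sum of superpositions -/

section Generic

variable {D : ℕ} {F : Type*} [Fintype F]

/-- [folklore] **RECENTRING A STENCIL MASS LETTER**: a kernel whose `u`-centred weighted mass at rate `σ ≥ 0` is `≤ mS` has `c`-centred weighted mass (same rate)
`≤ mS·e^{2σ|u − c|₁}` (`|p − c|₁ ≤ |p − u|₁ + |u − c|₁` in both points). -/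
theorem stencil_mass_recentre {K : MKer D F} {σ mS : ℝ} (hσ : 0 ≤ σ) (u c : Site D)
    (hKs : Summable fun p : Site D × Site D => ∑ a, ∑ b, |K p.1 p.2 a b| * Real.exp (σ * (l1 (p.1 - u) + l1 (p.2 - u))))
    (hKm : ∑' p : Site D × Site D, ∑ a, ∑ b, |K p.1 p.2 a b| * Real.exp (σ * (l1 (p.1 - u) + l1 (p.2 - u))) ≤ mS) :
    (Summable fun p : Site D × Site D => ∑ a, ∑ b, |K p.1 p.2 a b| * Real.exp (σ * (l1 (p.1 - c) + l1 (p.2 - c)))) ∧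
      ∑' p : Site D × Site D, ∑ a, ∑ b, |K p.1 p.2 a b| * Real.exp (σ * (l1 (p.1 - c) + l1 (p.2 - c)))
        ≤ mS * Real.exp (2 * σ * l1 (u - c)) := by
  have hpt : ∀ p : Site D × Site D, ∑ a, ∑ b, |K p.1 p.2 a b| * Real.exp (σ * (l1 (p.1 - c) + l1 (p.2 - c)))
      ≤ (∑ a, ∑ b, |K p.1 p.2 a b| * Real.exp (σ * (l1 (p.1 - u) + l1 (p.2 - u)))) * Real.exp (2 * σ * l1 (u - c)) := by
    intro p
    rw [Finset.sum_mul]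
    refine Finset.sum_le_sum fun a _ => ?_
    rw [Finset.sum_mul]
    refine Finset.sum_le_sum fun b _ => ?_
    rw [mul_assoc, ← Real.exp_add]
    refine mul_le_mul_of_nonneg_left (Real.exp_le_exp.2 ?_) (abs_nonneg _)
    have h := mul_le_mul_of_nonneg_left (add_le_add (l1_sub_triangle p.1 u c) (l1_sub_triangle p.2 u c)) hσ
    linarith
  have h0 : ∀ p : Site D × Site D, 0 ≤ ∑ a, ∑ b, |K p.1 p.2 a b| * Real.exp (σ * (l1 (p.1 - c) + l1 (p.2 - c))) := fun p =>
    Finset.sum_nonneg fun a _ => Finset.sum_nonneg fun b _ => by positivity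
  have hs : Summable fun p : Site D × Site D =>
      (∑ a, ∑ b, |K p.1 p.2 a b| * Real.exp (σ * (l1 (p.1 - u) + l1 (p.2 - u)))) * Real.exp (2 * σ * l1 (u - c)) := hKs.mul_right _
  refine ⟨Summable.of_nonneg_of_le h0 hpt hs, ?_⟩
  calc ∑' p : Site D × Site D, ∑ a, ∑ b, |K p.1 p.2 a b| * Real.exp (σ * (l1 (p.1 - c) + l1 (p.2 - c)))
      ≤ ∑' p : Site D × Site D, (∑ a, ∑ b, |K p.1 p.2 a b| * Real.exp (σ * (l1 (p.1 - u) + l1 (p.2 - u)))) * Real.exp (2 * σ * l1 (u - c)) :=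
        Summable.tsum_le_tsum hpt (Summable.of_nonneg_of_le h0 hpt hs) hs
    _ = (∑' p : Site D × Site D, ∑ a, ∑ b, |K p.1 p.2 a b| * Real.exp (σ * (l1 (p.1 - u) + l1 (p.2 - u)))) * Real.exp (2 * σ * l1 (u - c)) :=
        tsum_mul_right
    _ ≤ mS * Real.exp (2 * σ * l1 (u - c)) := mul_le_mul_of_nonneg_right hKm (Real.exp_pos _).le

/-- [folklore] **THE MASS OF A FINITE SUM OF WEIGHTED SUPERPOSITIONS** (`GhostWordJetMass.mass_wsum_le` + `mass_finset_sum_le`): for a positive weight function `W`,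
stencils `K i u` with summable `W`-masses `≤ ρ i u` and weight letters `Σ'_u |w i u|·ρ i u ≤ M i`, the kernel `Σ_{i∈s} wsum (w i) (K i)` has summable `W`-mass
`≤ Σ_{i∈s} M i`. -/
theorem mass_sum_wsum_le {ι : Type*} (s : Finset ι) {w : ι → Site D → ℝ} {K : ι → Site D → MKer D F} {W : Site D × Site D → ℝ}
    {ρ : ι → Site D → ℝ} {M : ι → ℝ} (hW : ∀ p, 0 < W p)
    (hKs : ∀ i u, Summable fun p : Site D × Site D => ∑ a, ∑ b, |K i u p.1 p.2 a b| * W p)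
    (hKm : ∀ i u, ∑' p : Site D × Site D, ∑ a, ∑ b, |K i u p.1 p.2 a b| * W p ≤ ρ i u)
    (hws : ∀ i, Summable fun u => |w i u| * ρ i u) (hwm : ∀ i, ∑' u, |w i u| * ρ i u ≤ M i) :
    (Summable fun p : Site D × Site D => ∑ a, ∑ b, |(∑ i ∈ s, wsum (w i) (K i)) p.1 p.2 a b| * W p) ∧
      ∑' p : Site D × Site D, ∑ a, ∑ b, |(∑ i ∈ s, wsum (w i) (K i)) p.1 p.2 a b| * W p ≤ ∑ i ∈ s, M i :=
  mass_finset_sum_le s (fun p => (hW p).le) (fun i _ => (mass_wsum_le hW (hKs i) (hKm i) (hws i)).1)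
    fun i _ => (mass_wsum_le hW (hKs i) (hKm i) (hws i)).2.trans (hwm i)

end Generic

/-! ## §2 The packed first jet `vertexRedF n S μ y` of ANY first-jet pack: mass `≤ C_V·n⁻¹·mS` (UNCONDITIONAL) -/

section Vertex

variable {F : Type*} [Fintype F] (m : ℕ)

/-- [folklore] **THE FIRST JET's MASS FROM THE PACK's LETTER** (UNCONDITIONAL; any fibre `F`): for `0 ≤ σ ≤ κ′∕(16n)` (`κ′ = kappa163 4∕4`, `n = m + 1`) and a
first-jet pack `S` whose every stencil has `u`-centred weighted mass `Σ'_{(p,q)} Σ_{ab} |S κ′ u p q a b|·e^{σ(|p − u|₁ + |q − u|₁)} ≤ mS`, the centred weighted mass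
of the `ℋ`-superposition `vertexRedF n S μ y` at `n•y`, rate `σ`, is summable and
`≤ 4·(MG163 4·periodConst (kappa163 4) 3)·e^{κ′}·(1 + 16∕κ′)⁴ · n⁻¹ · mS` — per colour `Σ'_u |wH κ′ μ (u − n•y)|·mS·e^{2σ|u − n•y|₁} ≤ mS·(n⁵)⁻¹·C₄e^{κ′}·Zl 4 (κ′∕(8n))`
(`tsum_abs_wH_mul_exp_le`), four colours, `(n⁴)⁻¹·Zl ≤ (1 + 16∕κ′)⁴` (`Zl_kappa_le`). -/
theorem mass_vertexRedF_le {S : Fin 4 → Site 4 → MKer 4 F} {σ mS : ℝ} (hσ0 : 0 ≤ σ)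
    (hσ : σ ≤ kappa163 4 / 4 / (16 * ((m + 1 : ℕ) : ℝ)))
    (hSs : ∀ κ' u, Summable fun p : Site 4 × Site 4 => ∑ a, ∑ b, |S κ' u p.1 p.2 a b| * Real.exp (σ * (l1 (p.1 - u) + l1 (p.2 - u))))
    (hSm : ∀ κ' u, ∑' p : Site 4 × Site 4, ∑ a, ∑ b, |S κ' u p.1 p.2 a b| * Real.exp (σ * (l1 (p.1 - u) + l1 (p.2 - u))) ≤ mS)
    (μ : Fin 4) (y : Site 4) :
    (Summable fun p : Site 4 × Site 4 => ∑ a, ∑ b, |vertexRedF (m + 1) S μ y p.1 p.2 a b|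
        * Real.exp (σ * (l1 (p.1 - ((m + 1 : ℕ) : ℤ) • y) + l1 (p.2 - ((m + 1 : ℕ) : ℤ) • y)))) ∧
      ∑' p : Site 4 × Site 4, ∑ a, ∑ b, |vertexRedF (m + 1) S μ y p.1 p.2 a b|
          * Real.exp (σ * (l1 (p.1 - ((m + 1 : ℕ) : ℤ) • y) + l1 (p.2 - ((m + 1 : ℕ) : ℤ) • y)))
        ≤ 4 * (MG163 4 * periodConst (kappa163 4) 3) * Real.exp (kappa163 4 / 4) * (1 + 16 / (kappa163 4 / 4)) ^ 4
          * (((m + 1 : ℕ) : ℝ))⁻¹ * mS := by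
  have hn0 : (0 : ℝ) < ((m + 1 : ℕ) : ℝ) := by exact_mod_cast Nat.succ_pos m
  -- the source lemmas carry the generic-`d` numerals `3 + 1`, `3 + 2`
  have hσ' : σ ≤ kappa163 (3 + 1) / (3 + 1) / (16 * ((m + 1 : ℕ) : ℝ)) := by
    have e : kappa163 (3 + 1) / (3 + 1) / (16 * ((m + 1 : ℕ) : ℝ)) = kappa163 4 / 4 / (16 * ((m + 1 : ℕ) : ℝ)) := by norm_num
    rw [e]; exact hσ
  set C : ℝ := ((((m + 1 : ℕ) : ℝ)) ^ (3 + 2))⁻¹ * (MG163 (3 + 1) * periodConst (kappa163 (3 + 1)) 3) * Real.exp (kappa163 (3 + 1) / (3 + 1))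
    with hC
  set Z : ℝ := Zl 4 (kappa163 (3 + 1) / (3 + 1) / (8 * ((m + 1 : ℕ) : ℝ))) with hZ
  have hC0 : 0 ≤ C := wH_const_nonneg m
  have hZ0 : 0 ≤ Z := Zl_nonneg (by have := kappa163_pos (3 + 1); positivity)
  set c : Site 4 := ((m + 1 : ℕ) : ℤ) • y with hc
  set W : Site 4 × Site 4 → ℝ := fun p => Real.exp (σ * (l1 (p.1 - c) + l1 (p.2 - c))) with hW
  have hWpos : ∀ p, 0 < W p := fun p => Real.exp_pos _
  have hmS : 0 ≤ mS :=
    (tsum_nonneg fun p => Finset.sum_nonneg fun a _ => Finset.sum_nonneg fun b _ => by positivity).trans (hSm 0 0)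
  -- per stencil: recentred letter `ρ u = mS·e^{2σ|u − c|₁}`
  have hrec : ∀ κ' u, (Summable fun p : Site 4 × Site 4 => ∑ a, ∑ b, |S κ' u p.1 p.2 a b| * W p) ∧
      ∑' p : Site 4 × Site 4, ∑ a, ∑ b, |S κ' u p.1 p.2 a b| * W p ≤ mS * Real.exp (2 * σ * l1 (u - c)) :=
    fun κ' u => stencil_mass_recentre hσ0 u c (hSs κ' u) (hSm κ' u)
  -- per colour: the weight letter `Σ'_u |wH|·ρ u ≤ mS·C·Z`
  have hw : ∀ κ' : Fin 4, (Summable fun u : Site 4 => |wH (d := 3) (N := m + 1) κ' μ (u - c)| * (mS * Real.exp (2 * σ * l1 (u - c)))) ∧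
      ∑' u : Site 4, |wH (d := 3) (N := m + 1) κ' μ (u - c)| * (mS * Real.exp (2 * σ * l1 (u - c))) ≤ mS * (C * Z) := by
    intro κ'
    obtain ⟨hs, hb⟩ := tsum_abs_wH_mul_exp_le m hσ' κ' μ y
    rw [← hc] at hs hb
    have e : (fun u : Site 4 => |wH (d := 3) (N := m + 1) κ' μ (u - c)| * (mS * Real.exp (2 * σ * l1 (u - c))))
        = fun u => mS * (|wH (d := 3) (N := m + 1) κ' μ (u - c)| * Real.exp (2 * σ * l1 (u - c))) := funext fun u => by ring
    rw [e]
    refine ⟨hs.mul_left mS, ?_⟩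
    rw [tsum_mul_left]
    exact mul_le_mul_of_nonneg_left hb hmS
  have hsum := mass_sum_wsum_le (Finset.univ : Finset (Fin 4)) (w := fun κ' u => wH (d := 3) (N := m + 1) κ' μ (u - c))
    (K := fun κ' u => S κ' u) (M := fun _ => mS * (C * Z)) hWpos (fun κ' u => (hrec κ' u).1) (fun κ' u => (hrec κ' u).2)
    (fun κ' => (hw κ').1) (fun κ' => (hw κ').2)
  rw [← vertexRedF_eq_sum (m + 1) S μ y] at hsum
  refine ⟨hsum.1, hsum.2.trans ?_⟩
  rw [Finset.sum_const, Finset.card_univ, Fintype.card_fin, nsmul_eq_mul]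
  -- the count: `4·mS·C·Z = 4·K₀·((n⁵)⁻¹·Z)·mS ≤ 4·K₀·(1 + 16∕κ′)⁴·n⁻¹·mS`
  have hK0 : 0 ≤ (MG163 (3 + 1) * periodConst (kappa163 (3 + 1)) 3) * Real.exp (kappa163 (3 + 1) / (3 + 1)) := by
    have hn5 : 0 < ((((m + 1 : ℕ) : ℝ)) ^ (3 + 2))⁻¹ := by positivity
    have h := hC0
    rw [hC, mul_assoc] at h
    exact (mul_nonneg_iff_of_pos_left hn5).1 h
  have hZl := Zl_kappa_le m
  rw [← hZ] at hZl
  have e1 : ((4 : ℕ) : ℝ) * (mS * (C * Z))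
      = 4 * ((MG163 (3 + 1) * periodConst (kappa163 (3 + 1)) 3) * Real.exp (kappa163 (3 + 1) / (3 + 1)))
        * (((((m + 1 : ℕ) : ℝ)) ^ 4)⁻¹ * Z) * (((m + 1 : ℕ) : ℝ))⁻¹ * mS := by
    rw [hC]; push_cast; field_simp
  rw [e1]
  have e2 : 4 * (MG163 4 * periodConst (kappa163 4) 3) * Real.exp (kappa163 4 / 4) * (1 + 16 / (kappa163 4 / 4)) ^ 4
      * (((m + 1 : ℕ) : ℝ))⁻¹ * mS
      = 4 * ((MG163 (3 + 1) * periodConst (kappa163 (3 + 1)) 3) * Real.exp (kappa163 (3 + 1) / (3 + 1)))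
        * (1 + 16 / (kappa163 (3 + 1) / (3 + 1))) ^ 4 * (((m + 1 : ℕ) : ℝ))⁻¹ * mS := by
    norm_num [mul_assoc]
  rw [e2]
  have hrest : 0 ≤ (((m + 1 : ℕ) : ℝ))⁻¹ * mS := mul_nonneg (inv_nonneg.2 hn0.le) hmS
  have h4 : 0 ≤ 4 * ((MG163 (3 + 1) * periodConst (kappa163 (3 + 1)) 3) * Real.exp (kappa163 (3 + 1) / (3 + 1))) := by positivity
  calc 4 * ((MG163 (3 + 1) * periodConst (kappa163 (3 + 1)) 3) * Real.exp (kappa163 (3 + 1) / (3 + 1)))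
        * (((((m + 1 : ℕ) : ℝ)) ^ 4)⁻¹ * Z) * (((m + 1 : ℕ) : ℝ))⁻¹ * mS
      = (4 * ((MG163 (3 + 1) * periodConst (kappa163 (3 + 1)) 3) * Real.exp (kappa163 (3 + 1) / (3 + 1)))
        * (((((m + 1 : ℕ) : ℝ)) ^ 4)⁻¹ * Z)) * ((((m + 1 : ℕ) : ℝ))⁻¹ * mS) := by ring
    _ ≤ (4 * ((MG163 (3 + 1) * periodConst (kappa163 (3 + 1)) 3) * Real.exp (kappa163 (3 + 1) / (3 + 1)))
        * (1 + 16 / (kappa163 (3 + 1) / (3 + 1))) ^ 4) * ((((m + 1 : ℕ) : ℝ))⁻¹ * mS) :=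
        mul_le_mul_of_nonneg_right (mul_le_mul_of_nonneg_left hZl h4) hrest
    _ = _ := by ring

end Vertex

section Packed

variable (m : ℕ)

/-- [our object] **EVERY BLOCK OF A PACKED CHAIN-RULE VERTEX IS THE `ℋ`-SUPERPOSITION OF THE PACK's BLOCKS** (definitional; the all-block form of
`PackedKernelSplit.ffV_vertexOf`): `blk (vertexOf S μ y) j k = vertexRedF n (S·jk) μ y`. -/
theorem blk_vertexOf (n : ℕ) [NeZero n] (S : Fin 4 → Site 4 → MKer 4 (Fib 3)) (μ : Fin 4) (y : Site 4) (j k : Bool) :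
    blk (vertexOf (d := 3) (N := n) S μ y) j k = vertexRedF n (fun κ u => blk (S κ u) j k) μ y := by
  funext x z a b
  rfl

/-- [folklore] **THE BLOCK MASSES OF A PACKED FIRST JET** (UNCONDITIONAL): for `0 ≤ σ ≤ κ′∕(16n)` and a PACKED first-jet pack `S` (fibre `Fib 3`) with block
mass letters `Σ'|blk (S κ′ u) j k|·e^{σ(|p − u|₁ + |q − u|₁)} ≤ mS j k`, every block of `vertexOf S μ y` has centred weighted mass at `n•y`, rate `σ`,
`≤ 4·(MG163 4·periodConst (kappa163 4) 3)·e^{κ′}·(1 + 16∕κ′)⁴ · n⁻¹ · mS j k`. -/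
theorem mass_blk_vertexOf_le {S : Fin 4 → Site 4 → MKer 4 (Fib 3)} {σ : ℝ} {mS : Bool → Bool → ℝ} (hσ0 : 0 ≤ σ)
    (hσ : σ ≤ kappa163 4 / 4 / (16 * ((m + 1 : ℕ) : ℝ)))
    (hSs : ∀ κ' u j k, Summable fun p : Site 4 × Site 4 =>
      ∑ g, ∑ f, |blk (S κ' u) j k p.1 p.2 g f| * Real.exp (σ * (l1 (p.1 - u) + l1 (p.2 - u))))
    (hSm : ∀ κ' u j k, ∑' p : Site 4 × Site 4,
      ∑ g, ∑ f, |blk (S κ' u) j k p.1 p.2 g f| * Real.exp (σ * (l1 (p.1 - u) + l1 (p.2 - u))) ≤ mS j k)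
    (μ : Fin 4) (y : Site 4) (j k : Bool) :
    (Summable fun p : Site 4 × Site 4 => ∑ g, ∑ f, |blk (vertexOf (d := 3) (N := m + 1) S μ y) j k p.1 p.2 g f|
        * Real.exp (σ * (l1 (p.1 - ((m + 1 : ℕ) : ℤ) • y) + l1 (p.2 - ((m + 1 : ℕ) : ℤ) • y)))) ∧
      ∑' p : Site 4 × Site 4, ∑ g, ∑ f, |blk (vertexOf (d := 3) (N := m + 1) S μ y) j k p.1 p.2 g f|
          * Real.exp (σ * (l1 (p.1 - ((m + 1 : ℕ) : ℤ) • y) + l1 (p.2 - ((m + 1 : ℕ) : ℤ) • y)))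
        ≤ 4 * (MG163 4 * periodConst (kappa163 4) 3) * Real.exp (kappa163 4 / 4) * (1 + 16 / (kappa163 4 / 4)) ^ 4
          * (((m + 1 : ℕ) : ℝ))⁻¹ * mS j k := by
  rw [blk_vertexOf]
  exact mass_vertexRedF_le m hσ0 hσ (fun κ' u => hSs κ' u j k) (fun κ' u => hSm κ' u j k) μ y

end Packed

/-! ## §3 The road's packed first jets `vertexOfK (NlegRoad m a) n S` (mod `h12 ∧ h126`) -/

section Road

variable (m : ℕ) {a : ℝ} (ha : 0 < a)
include ha

/-- [folklore] **THE BLOCK MASSES OF THE ROAD's PACKED FIRST JETS**: modulo [B5, Prop. 1.2] ∧ [B5, (1.126)–(1.127)] BY NAME (the read-out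
`NlegKHessSplit.vertexOfK_NlegRoad_eq_vertexOf`: the chain-rule vertex through the N-leg's `ℋ_R`-column IS `vertexOf`), for `0 ≤ σ ≤ κ′∕(16n)` and any PACKED
first-jet pack `S` with block mass letters `mS j k` at rate `σ`, every block of `vertexOfK (NlegRoad m a) n S μ y` has centred weighted mass at `n•y`
`≤ 4·(MG163 4·periodConst (kappa163 4) 3)·e^{κ′}·(1 + 16∕κ′)⁴ · n⁻¹ · mS j k` — the `hVs ∕ hVm` letters of `RestKernelBlockUnit` §3 with `mV j k := C_V·n⁻¹·mS j k`. -/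
theorem mass_blk_vertexOfK_NlegRoad_le (h12 : B5.Prop12Printed (fam nOf hn1 MOf a ha)) (h126 : B5.Kernel126_127Printed (kfam nOf MOf))
    {S : Fin 4 → Site 4 → MKer 4 (Fib 3)} {σ : ℝ} {mS : Bool → Bool → ℝ} (hσ0 : 0 ≤ σ)
    (hσ : σ ≤ kappa163 4 / 4 / (16 * ((m + 1 : ℕ) : ℝ)))
    (hSs : ∀ κ' u j k, Summable fun p : Site 4 × Site 4 =>
      ∑ g, ∑ f, |blk (S κ' u) j k p.1 p.2 g f| * Real.exp (σ * (l1 (p.1 - u) + l1 (p.2 - u))))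
    (hSm : ∀ κ' u j k, ∑' p : Site 4 × Site 4,
      ∑ g, ∑ f, |blk (S κ' u) j k p.1 p.2 g f| * Real.exp (σ * (l1 (p.1 - u) + l1 (p.2 - u))) ≤ mS j k)
    (μ : Fin 4) (y : Site 4) (j k : Bool) :
    (Summable fun p : Site 4 × Site 4 => ∑ g, ∑ f, |blk (vertexOfK (NlegRoad m a) (m + 1) S μ y) j k p.1 p.2 g f|
        * Real.exp (σ * (l1 (p.1 - ((m + 1 : ℕ) : ℤ) • y) + l1 (p.2 - ((m + 1 : ℕ) : ℤ) • y)))) ∧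
      ∑' p : Site 4 × Site 4, ∑ g, ∑ f, |blk (vertexOfK (NlegRoad m a) (m + 1) S μ y) j k p.1 p.2 g f|
          * Real.exp (σ * (l1 (p.1 - ((m + 1 : ℕ) : ℤ) • y) + l1 (p.2 - ((m + 1 : ℕ) : ℤ) • y)))
        ≤ 4 * (MG163 4 * periodConst (kappa163 4) 3) * Real.exp (kappa163 4 / 4) * (1 + 16 / (kappa163 4 / 4)) ^ 4
          * (((m + 1 : ℕ) : ℝ))⁻¹ * mS j k := by
  rw [vertexOfK_NlegRoad_eq_vertexOf m ha h12 h126 S μ y]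
  exact mass_blk_vertexOf_le m hσ0 hσ hSs hSm μ y j k

/-! ## §4 The fifteen RK-BLK bubble words at the road's packed first jets: n-free rate, `n⁻⁷ ×` the pack's block letters -/

/-- [folklore] **«RK-BLK BUBBLES AT THE ROAD's PACKED FIRST JETS»**: modulo [B5, Prop. 1.2] ∧ [B5, (1.126)–(1.127)] BY NAME there is ONE n-free triple
`kG, K ≥ 0`, `c > 0` such that for every `m` (`n = m + 1`), every PACKED first-jet pack `S` whose block mass letters `mS j k` hold at the rate `c∕n`, every
table family `W`, all directions `μ ν` and all sides `(i, j, k, l)`,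
`Decay510 (blockWord (NlegRoad m a) (vertexOfK (NlegRoad m a) n S) W (inr (i, j, k, l)) μ ν) (½·T_ij·T_kl·(C_V·n⁻¹·mS j k)·(C_V·n⁻¹·mS l i)) c` — the RATE `c` IS
n-FREE (`σ·n` with `σ = c∕n`), `T` is the leg table of `RestKernelBlockUnit.exists_road_block_legs` (ff `kG∕2 + K∕2∕n²`, fm∕mf `(n⁵)⁻¹·C₄·e^{κ′}`, mm `2·(n⁸)⁻¹·c166Z 3`;
`≥` one non-ff factor per genuine word by `road_block_leg_nonff_le`), `C_V = 4·C₄·e^{κ′}·(1 + 16∕κ′)⁴`: every genuine bubble word is `n⁻⁷ × mS_jk(n)·mS_li(n) ×` n-free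
letters.  Here `c = min c_BLK (kappa163 4∕64)` (`c_BLK` the rate of `exists_road_block_legs`).  The (1.22) rows follow by `B12Sec2to5.secondMoment_abs_le_of_decay510`. -/
theorem exists_decay510_blockWord_inr_packed (h12 : B5.Prop12Printed (fam nOf hn1 MOf a ha)) (h126 : B5.Kernel126_127Printed (kfam nOf MOf)) :
    ∃ kG K c : ℝ, 0 < c ∧ 0 ≤ kG ∧ 0 ≤ K ∧ ∀ (m : ℕ) (S : Fin 4 → Site 4 → MKer 4 (Fib 3))
      (W : Fin 4 → Site 4 → Fin 4 → Site 4 → MKer 4 (Fib 3)) (mS : Bool → Bool → ℝ) (μ ν : Fin 4),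
      (∀ κ' u j k, Summable fun p : Site 4 × Site 4 =>
        ∑ g, ∑ f, |blk (S κ' u) j k p.1 p.2 g f| * Real.exp (c / ((m + 1 : ℕ) : ℝ) * (l1 (p.1 - u) + l1 (p.2 - u)))) →
      (∀ κ' u j k, ∑' p : Site 4 × Site 4,
        ∑ g, ∑ f, |blk (S κ' u) j k p.1 p.2 g f| * Real.exp (c / ((m + 1 : ℕ) : ℝ) * (l1 (p.1 - u) + l1 (p.2 - u))) ≤ mS j k) →
      ∀ i j k l : Bool, Decay510 (blockWord (NlegRoad m a) (vertexOfK (NlegRoad m a) (m + 1) S) W (Sum.inr (i, j, k, l)) μ ν)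
        ((1 / 2) * ((bif (i && j) then kG / 2 + K / 2 / (((m + 1 : ℕ) : ℝ)) ^ 2
            else bif (i || j) then ((((m + 1 : ℕ) : ℝ)) ^ 5)⁻¹ * (MG163 4 * periodConst (kappa163 4) 3) * Real.exp (kappa163 4 / 4)
            else 2 * ((((m + 1 : ℕ) : ℝ)) ^ 8)⁻¹ * c166Z 3)
          * (bif (k && l) then kG / 2 + K / 2 / (((m + 1 : ℕ) : ℝ)) ^ 2
            else bif (k || l) then ((((m + 1 : ℕ) : ℝ)) ^ 5)⁻¹ * (MG163 4 * periodConst (kappa163 4) 3) * Real.exp (kappa163 4 / 4)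
            else 2 * ((((m + 1 : ℕ) : ℝ)) ^ 8)⁻¹ * c166Z 3)
          * (4 * (MG163 4 * periodConst (kappa163 4) 3) * Real.exp (kappa163 4 / 4) * (1 + 16 / (kappa163 4 / 4)) ^ 4
              * (((m + 1 : ℕ) : ℝ))⁻¹ * mS j k)
          * (4 * (MG163 4 * periodConst (kappa163 4) 3) * Real.exp (kappa163 4 / 4) * (1 + 16 / (kappa163 4 / 4)) ^ 4
              * (((m + 1 : ℕ) : ℝ))⁻¹ * mS l i))) c := by
  obtain ⟨kG, K, c₁, hc₁, hkG, hK, hlegs⟩ := exists_road_block_legs ha h12 h126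
  have hκ : 0 < kappa163 4 := kappa163_pos 4
  refine ⟨kG, K, min c₁ (kappa163 4 / 64), lt_min hc₁ (by positivity), hkG, hK, fun m S W mS μ ν hSs hSm i j k l => ?_⟩
  have hn0 : (0 : ℝ) < ((m + 1 : ℕ) : ℝ) := by exact_mod_cast Nat.succ_pos m
  set c : ℝ := min c₁ (kappa163 4 / 64) with hcdef
  have hc0 : 0 < c := lt_min hc₁ (by positivity)
  set σ : ℝ := c / ((m + 1 : ℕ) : ℝ) with hσdef
  have hσ0 : 0 ≤ σ := by positivity
  have hσ1 : σ ≤ c₁ / ((m + 1 : ℕ) : ℝ) := div_le_div_of_nonneg_right (min_le_left _ _) hn0.le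
  have hσκ : σ ≤ kappa163 4 / 4 / (16 * ((m + 1 : ℕ) : ℝ)) := by
    calc σ ≤ (kappa163 4 / 64) / ((m + 1 : ℕ) : ℝ) := div_le_div_of_nonneg_right (min_le_right _ _) hn0.le
      _ = kappa163 4 / 4 / (16 * ((m + 1 : ℕ) : ℝ)) := by ring
  -- the leg table at blocking `n`
  set T : Bool → Bool → ℝ := fun i j =>
    bif (i && j) then kG / 2 + K / 2 / (((m + 1 : ℕ) : ℝ)) ^ 2
      else bif (i || j) then ((((m + 1 : ℕ) : ℝ)) ^ 5)⁻¹ * (MG163 4 * periodConst (kappa163 4) 3) * Real.exp (kappa163 4 / 4)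
      else 2 * ((((m + 1 : ℕ) : ℝ)) ^ 8)⁻¹ * c166Z 3 with hT
  have hT0 : ∀ i j, 0 ≤ T i j := fun i j => (hlegs m i j).nonneg 0
  have hKσ : ∀ i j, Decays (blk (NlegRoad m a) i j) (T i j) σ := fun i j => by
    have h := decays_of_le (hlegs m i j) hσ1
    rwa [abs_of_nonneg (hT0 i j)] at h
  -- the jets' block masses from the pack's letters
  have hV := fun ρ y j' k' => mass_blk_vertexOfK_NlegRoad_le m ha h12 h126 (mS := mS) hσ0 hσκ hSs hSm ρ y j' k'
  have h := decay510_blockWord_inr (K := NlegRoad m a) (V := vertexOfK (NlegRoad m a) (m + 1) S) (W := W) (N := m + 1)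
    (mV := fun j k => 4 * (MG163 4 * periodConst (kappa163 4) 3) * Real.exp (kappa163 4 / 4) * (1 + 16 / (kappa163 4 / 4)) ^ 4
      * (((m + 1 : ℕ) : ℝ))⁻¹ * mS j k)
    hKσ hσ0 hT0 μ ν (fun ρ y j' k' => (hV ρ y j' k').1) (fun ρ y j' k' => (hV ρ y j' k').2) i j k l
  have e : σ * ((m + 1 : ℕ) : ℝ) = c := by rw [hσdef]; field_simp
  rw [e] at h
  exact h

end Road

end Summit.QuantumFields.BalabanUV.Beta.D1BFx.RestJetBlockMass

end
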